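import Literature.Probability.RandomPlanarGeometry.SAWCountZdSymbolPolynomiality
import Literature.Probability.RandomPlanarGeometry.SAWPulledLargeForceExpansionZdTenStep
import HarnessLib

/-!
# The symbol polynomial `R_j` has degree at most `2j − 3`: a run-wise zero block has length at least four

Topic `Literature/Probability/RandomPlanarGeometry` (the «SYMBOL POLYNOMIALITY» programme: `SAWCountZdRepeatSetShapes.lean` (the shape classes
`shapeClass j u A`, run-wise reversal-freeness `RunNoRev`, run-wise repeats `RunHasRep`), `SAWCountZdSymbolPolynomiality.lean` (`#T_j(n) = 2^n R_j(n)`,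
`R_j = symbolPoly j`, `natDegree_symbolPoly_le : deg R_j ≤ 2j`), block sums `bsumW` of `…ZdNineStep`/`…ZdTenStep` (`wordPos_eq_iff_bsumW`, `bsumW_ne_zero_of_odd`, `bsumW_succ`)).

PRINTED CONTEXT (locators only). Madras–Slade (1993) §1.1 eq. (1.1.8) p. 5, Definition 1.2.4, §1.2 p. 10; Clisby–Liang–Slade (2007) §3.3. The degree
bound below is the lane's (it explains the observed degrees `3, 5, 7` of `R₃, R₄, R₅`: CAR M's cubic, the (L1′) quintic, the (L1″) septic).

THIS FILE: ★ `four_le_of_runHasRep` — in a run-wise reversal-free word a run-wise repeat `[i, i')` has length `i' − i ≥ 4` (length 1: a step is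
non-zero; length 2: the two letters would be a reversal INSIDE the run; length 3: an odd block never sums to zero); ★ `breaks_add_three_le_of_mem_shapeClass`
— a non-empty shape class `shapeClass j u A` forces three adjacent pairs inside one run, so `breaks A + 3 ≤ u`; ★★ `natDegree_symbolPoly_le_sub_three :
(symbolPoly j).natDegree ≤ 2j − 3` — the `1/d`-symbol `[d^{n−j}] c_n(ℤ^d) · 2^{−n}` is a polynomial in `n` of degree at most `2j − 3`.
[cite: MadrasSlade1993, §1.1 eq. (1.1.8) p. 5; Definition 1.2.4] [cite: ClisbyLiangSlade2007, §3.3 eqs. (29)/(31)]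

Provenance: lane «pcv-sawmu», a-p1 g23 (2026-08-27).
-/

open Finset
open scoped BigOperators
open Literature.Probability.LatticeModels
open Literature.Probability.RandomPlanarGeometry.SAW
open Literature.Probability.Percolation

namespace Literature.Probability.RandomPlanarGeometry.SAW.Zd

namespace WordTypes

variable {u n : ℕ}

/-- ★ A RUN-WISE REPEAT HAS LENGTH AT LEAST FOUR: if `κ` is run-wise reversal-free for `A` and `[i, i')` is a zero block all of whose internal
adjacent pairs are `A`-adjacent, then `i + 4 ≤ i'`. [cite: MadrasSlade1993, Definition 1.2.4; lane lemma] -/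
theorem four_le_of_zero_block (A : Fin u → Bool) (κ : Word u n) (hnr : RunNoRev A κ) {i i' : ℕ} (hii' : i < i') (hi' : i' ≤ u)
    (hA : ∀ k : Fin u, i ≤ k.val → k.val + 1 < i' → A k = true) (hpos : wordPos κ i = wordPos κ i') : i + 4 ≤ i' := by
  have hz : bsumW κ i i' = 0 := (wordPos_eq_iff_bsumW κ hii'.le hi').1 hpos
  by_contra hlt
  push Not at hlt
  -- lengths 1 and 3 are odd
  rcases (show i' = i + 1 ∨ i' = i + 2 ∨ i' = i + 3 by omega) with h1 | h2 | h3
  · exact bsumW_ne_zero_of_odd κ hi' (by rw [h1]; omega) hz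
  · -- length 2: the two letters are a reversal across an `A`-adjacent pair
    subst h2
    have hlt1 : i + 1 < u := by omega
    rw [bsumW_succ κ (by omega) hlt1, bsumW_succ κ le_rfl (by omega), bsumW_self, zero_add] at hz
    have hrev := twoStepV_add_eq_zero n hz
    have hAi : A ⟨i, by omega⟩ = true := hA ⟨i, by omega⟩ le_rfl (by simp)
    exact hnr ⟨i, by omega⟩ hlt1 hAi hrev
  · exact bsumW_ne_zero_of_odd κ hi' (by rw [h3]; omega) hz

open Classical in
/-- ★ A NON-EMPTY SHAPE CLASS HAS THREE ADJACENT PAIRS IN ONE RUN: `κ ∈ shapeClass j u A ⇒ breaks A + 3 ≤ u`.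
[cite: MadrasSlade1993, Definition 1.2.4; lane lemma] -/
theorem breaks_add_three_le_of_mem_shapeClass {j : ℕ} {A : Fin u → Bool} {κ : Word u u} (hκ : κ ∈ shapeClass j u A) :
    breaks A + 3 ≤ u := by
  unfold shapeClass at hκ
  simp only [Finset.mem_filter, Finset.mem_univ, true_and] at hκ
  obtain ⟨-, -, -, hnr, i, i', hii', hi', hA, hpos⟩ := hκ
  have h4 := four_le_of_zero_block A κ hnr hii' hi' hA hpos
  -- the three pairs `i, i+1, i+2` are `A`-adjacent
  have hsub : ({⟨i, by omega⟩, ⟨i + 1, by omega⟩, ⟨i + 2, by omega⟩} : Finset (Fin u)) ⊆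
      Finset.univ.filter fun k : Fin u => A k = true := by
    intro k hk
    simp only [Finset.mem_insert, Finset.mem_singleton] at hk
    rw [Finset.mem_filter]
    refine ⟨Finset.mem_univ _, ?_⟩
    rcases hk with rfl | rfl | rfl
    · exact hA _ le_rfl (by simp; omega)
    · exact hA _ (by simp) (by simp; omega)
    · exact hA _ (by simp) (by simp; omega)
  have h3 : 3 ≤ (Finset.univ.filter fun k : Fin u => A k = true).card := by
    refine le_trans (le_of_eq ?_) (Finset.card_le_card hsub)
    rw [Finset.card_insert_of_notMem, Finset.card_insert_of_notMem, Finset.card_singleton]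
    · simp [Fin.ext_iff]
    · simp [Fin.ext_iff]
  have hsum : (Finset.univ.filter fun k : Fin u => A k = false).card + (Finset.univ.filter fun k : Fin u => A k = true).card = u := by
    have := Finset.card_filter_add_card_filter_not (s := (Finset.univ : Finset (Fin u))) (fun k : Fin u => A k = false)
    simp only [Finset.card_univ, Fintype.card_fin, Bool.not_eq_false] at this
    exact this
  unfold breaks
  omega

open Classical in
/-- ★★ THE SYMBOL POLYNOMIAL HAS DEGREE AT MOST `2j − 3`: `natDegree (symbolPoly j) ≤ 2j − 3` — every non-empty shape class lives on `u ≤ 2j` letters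
with `breaks A ≤ u − 3`, and the class term is a binomial polynomial of degree `breaks A`. So the `1/d`-symbol `2^{−n}·[d^{n−j}] c_n(ℤ^d)` (`n ≥ 2j − 1`)
is a polynomial in `n` of degree `≤ 2j − 3` (observed: `3, 5, 7` for `j = 3, 4, 5`). [cite: MadrasSlade1993, §1.1 eq. (1.1.8) p. 5; Definition 1.2.4]
[cite: ClisbyLiangSlade2007, §3.3 eqs. (29)/(31); lane theorem] -/
theorem natDegree_symbolPoly_le_sub_three (j : ℕ) : (symbolPoly j).natDegree ≤ 2 * j - 3 := by
  unfold symbolPoly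
  refine Polynomial.natDegree_sum_le_of_forall_le _ _ fun u hu => ?_
  refine Polynomial.natDegree_sum_le_of_forall_le _ _ fun A _ => ?_
  split_ifs with hv
  · by_cases hne : (shapeClass j u A).card = 0
    · rw [hne]; simp
    · obtain ⟨κ, hκ⟩ := Finset.card_pos.1 (Nat.pos_of_ne_zero hne)
      have h3 := breaks_add_three_le_of_mem_shapeClass hκ
      have hu2 : u ≤ 2 * j := by
        by_contra h
        rw [shapeClass_eq_empty j u A (by omega)] at hκ
        simp at hκ
      refine (Polynomial.natDegree_C_mul_le _ _).trans ?_
      refine Polynomial.natDegree_comp_le.trans ?_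
      rw [descPochhammer_natDegree, Polynomial.natDegree_X_add_C, mul_one]
      omega
  · simp

end WordTypes

end Literature.Probability.RandomPlanarGeometry.SAW.Zd
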